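import Mathlib.Computability.Language
import Mathlib.LinearAlgebra.Matrix.RowCol
import Literature.Algebra.EuclideanLattices.SuccessiveMinima
import Literature.Algebra.EuclideanLattices.IntegerBases
import Literature.Algebra.EuclideanLattices.Problems
import Literature.Algebra.EuclideanLattices.Encoding
import HarnessLib

-- provenance: harness21/H21/H21/Statements/PQC/LatticeProblems.lean @ 99832fe (interim HEAD d8f2665); M5 mechanical rewrite
/-!
# PQC family: the computational lattice problems SVP, CVP, SIVP, GapSVP, GapCVP, uSVP

Family `pqc`, trunk T-LATTICE (G10). Namespace `Literature.PQC`.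

This statement file records **pqc.S14** — the approximate lattice problems `SVP_γ`, `CVP_γ`,
`SIVP_γ` and the promise problems `GapSVP_γ`, `GapCVP_γ` (Micciancio–Goldwasser, *Complexity of
Lattice Problems* (2002), Ch. 1, Defs. 1.1–1.5 and §1.2; Peikert, *A decade of lattice
cryptography* (2016), §2.2; Regev, *On lattices, learning with errors, …*, J. ACM (2009), §1).
The item has *definition role*: the definitions themselves are the accepted prelude notions
`Literature.Algebra.EuclideanLattices.SVP.IsSolution`, `CVP.IsSolution`, `SIVP.IsSolution`, `GapSVP.yes/no`,
`GapCVP.yes/no`, `USVP.Promise`, `BDD.Promise` (`H21/Prelude/Lattice/Problems`) and the Boolean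
encodings `GapSVPInstance.encode`, `GapCVPInstance.encode` (`H21/Prelude/Lattice/Encoding`).
The acceptance content stated here is:

* the unfolding lemmas `mem_gapSVP_yes_iff`, `mem_gapSVP_no_iff`, `mem_gapCVP_yes_iff`,
  `mem_gapCVP_no_iff` (these carry the id **pqc.S14**);
* the *encoded languages* `GapSVP.yesLang γ`, `GapSVP.noLang γ`, `GapCVP.yesLang γ`,
  `GapCVP.noLang γ : Language Bool` (images of the YES/NO sets under the instance encodings) with
  their membership lemmas and the disjointness theorems `gapSVP_lang_disjoint`,
  `gapCVP_lang_disjoint` for `γ ≥ 1`.  The pair `(GapSVP.yesLang γ, GapSVP.noLang γ)` together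
  with `gapSVP_lang_disjoint` is exactly the input that G01's `PromiseProblem.ofEncoding`
  (trunk CplxCore, item `Promise`; DEPENDENCY, not imported here) wraps into a promise problem
  over `Bool`; this file deliberately imports nothing from that item;
* `svp_decides_gapSVP`: the trivial reduction from `GapSVP_γ` to `SVP_γ` — the test
  `‖v‖ ≤ γ(n) · d` on any `SVP_γ` solution `v` accepts every YES instance and rejects every NO
  instance (Micciancio–Goldwasser 2002, Ch. 1, §1.2);
* `gapSVP_reduces_to_gapCVP`: the Goldreich–Micciancio–Safra–Seifert (1999) reduction from
  `GapSVP_γ` to `GapCVP_γ` in its mathematical form (`(B, d)` is a YES instance iff some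
  `(B⁽ⁱ⁾, bᵢ, d)` is, and a NO instance only if all of them are, where `B⁽ⁱ⁾` doubles the `i`-th
  basis vector), proof `sorry`;
* sanity lemmas `sivp_solution_norm_le` and `usvp_promise_iff`.

## Mathlib

Mathlib has `Language α := Set (List α)` (`Mathlib/Computability/Language`),
`Computability.Encoding`, `Matrix.updateRow`, `Set.disjoint_image_iff`, but none of the lattice
problems (searched `SVP`, `GapSVP`, `shortest vector`, `closest vector`, `PromiseProblem`).
Encoded languages are built with G01's `Computability.Encoding.toLanguage e S = e.encode '' S`
(`H21/Prelude/CplxCore/BoolEncodings`).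

## Design choices

* Languages are typed `Language Bool` (definitionally `Set (List Bool)`), the type consumed by
  the complexity-class preludes; `GapSVP.yesLang_eq_image` records the defining equation
  `yesLang γ = GapSVPInstance.encode '' GapSVP.yes γ`.
* The GMSS reduction is stated at the level of instances (no Turing machines): this is the
  mathematical heart of GMSS99, Thm. 1; its polynomial-time character is evident from the
  explicit map `gmssInstance` and is left to `LatticeComplexity.lean`.  The YES direction needs
  `n ≠ 0` (for `n = 0` the pair `(B, d)` is a YES instance — `λ₁(⊥) = 0` by the junk-value
  convention of `minNorm` — but there is no index `i`).
* `usvp_promise_iff` restates the `uSVP_γ` promise with `λ₁` written as the first successive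
  minimum, via `successiveMinimum_one_eq_minNorm`.
-/

noncomputable section

open Metric Computability Literature.Algebra.EuclideanLattices

namespace Literature.Algebra.EuclideanLattices

/-! ### pqc.S14: unfolding the YES/NO sets of the gap problems -/

/-- **pqc.S14** (`GapSVP_γ`, YES instances; Micciancio–Goldwasser 2002, Ch. 1, Def. 1.4 and
§1.2; Peikert 2016, Def. 2.2.2; Regev 2009, §1).  `(B, d)` is a YES instance of `GapSVP_γ` iff
`B` is nonsingular, `d > 0` and `λ₁(L(B)) ≤ d`. [cite: MicciancioGoldwasser2002, Ch. 1  Def. 1.4 and §1.2] -/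
theorem mem_gapSVP_yes_iff (γ : ℕ → ℝ) (I : LatticeInstance) (d : ℚ) :
    (I, d) ∈ GapSVP.yes γ ↔ I.IsNonsingular ∧ 0 < d ∧ minNorm I.lattice ≤ (d : ℝ) :=
  Iff.rfl

/-- **pqc.S14** (`GapSVP_γ`, NO instances; Micciancio–Goldwasser 2002, Ch. 1, §1.2; Peikert
2016, Def. 2.2.2; Regev 2009, §1).  `(B, d)` is a NO instance of `GapSVP_γ` iff `B` is
nonsingular, `d > 0` and `λ₁(L(B)) > γ(n) · d`. [cite: MicciancioGoldwasser2002, Ch. 1  §1.2] -/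
theorem mem_gapSVP_no_iff (γ : ℕ → ℝ) (I : LatticeInstance) (d : ℚ) :
    (I, d) ∈ GapSVP.no γ ↔ I.IsNonsingular ∧ 0 < d ∧ γ I.n * (d : ℝ) < minNorm I.lattice :=
  Iff.rfl

/-- **pqc.S14** (`GapCVP_γ`, YES instances; Micciancio–Goldwasser 2002, Ch. 1, Def. 1.5 and
§1.2; Peikert 2016, §2.2).  `((B, t), d)` is a YES instance of `GapCVP_γ` iff `B` is
nonsingular, `d > 0` and `dist(t, L(B)) ≤ d`. [cite: MicciancioGoldwasser2002, Ch. 1  Def. 1.5 and §1.2] -/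
theorem mem_gapCVP_yes_iff (γ : ℕ → ℝ) (c : CVPInstance) (d : ℚ) :
    (c, d) ∈ GapCVP.yes γ ↔
      c.I.IsNonsingular ∧ 0 < d ∧ infDist c.targetE c.I.lattice ≤ (d : ℝ) :=
  Iff.rfl

/-- **pqc.S14** (`GapCVP_γ`, NO instances; Micciancio–Goldwasser 2002, Ch. 1, Def. 1.5 and
§1.2; Peikert 2016, §2.2).  `((B, t), d)` is a NO instance of `GapCVP_γ` iff `B` is
nonsingular, `d > 0` and `dist(t, L(B)) > γ(n) · d`. [cite: MicciancioGoldwasser2002, Ch. 1  Def. 1.5 and §1.2] -/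
theorem mem_gapCVP_no_iff (γ : ℕ → ℝ) (c : CVPInstance) (d : ℚ) :
    (c, d) ∈ GapCVP.no γ ↔
      c.I.IsNonsingular ∧ 0 < d ∧ γ c.I.n * (d : ℝ) < infDist c.targetE c.I.lattice :=
  Iff.rfl

/-! ### Encoded languages -/

/-- The YES language of `GapSVP_γ` over `Bool`: the set of bit strings encoding a YES instance,
`GapSVPInstance.encode '' GapSVP.yes γ` (Micciancio–Goldwasser 2002, Ch. 1, §1.2, decision /
promise problems as languages; Arora–Barak 2009, §1.2).  Together with `GapSVP.noLang γ` and
`gapSVP_lang_disjoint` this is the input of G01's `PromiseProblem.ofEncoding` (dependency, not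
imported). [cite: MicciancioGoldwasser2002, Ch. 1  §1.2  decision / promise problems] -/
def GapSVP.yesLang (γ : ℕ → ℝ) : Language Bool :=
  gapSVPInstanceEncoding.toLanguage (GapSVP.yes γ)

/-- The NO language of `GapSVP_γ` over `Bool`: `GapSVPInstance.encode '' GapSVP.no γ`
(Micciancio–Goldwasser 2002, Ch. 1, §1.2; Arora–Barak 2009, §1.2). [cite: MicciancioGoldwasser2002, Ch. 1  §1.2] -/
def GapSVP.noLang (γ : ℕ → ℝ) : Language Bool :=
  gapSVPInstanceEncoding.toLanguage (GapSVP.no γ)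

/-- The YES language of `GapCVP_γ` over `Bool`: `GapCVPInstance.encode '' GapCVP.yes γ`
(Micciancio–Goldwasser 2002, Ch. 1, §1.2; Arora–Barak 2009, §1.2). [cite: MicciancioGoldwasser2002, Ch. 1  §1.2] -/
def GapCVP.yesLang (γ : ℕ → ℝ) : Language Bool :=
  gapCVPInstanceEncoding.toLanguage (GapCVP.yes γ)

/-- The NO language of `GapCVP_γ` over `Bool`: `GapCVPInstance.encode '' GapCVP.no γ`
(Micciancio–Goldwasser 2002, Ch. 1, §1.2; Arora–Barak 2009, §1.2). [cite: MicciancioGoldwasser2002, Ch. 1  §1.2] -/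
def GapCVP.noLang (γ : ℕ → ℝ) : Language Bool :=
  gapCVPInstanceEncoding.toLanguage (GapCVP.no γ)

/-- Defining equation: `GapSVP.yesLang γ = GapSVPInstance.encode '' GapSVP.yes γ`
(Arora–Barak 2009, §1.2). [cite: AroraBarak2009, §1.2] -/
theorem GapSVP.yesLang_eq_image (γ : ℕ → ℝ) :
    GapSVP.yesLang γ = GapSVPInstance.encode '' GapSVP.yes γ := rfl

/-- Defining equation: `GapSVP.noLang γ = GapSVPInstance.encode '' GapSVP.no γ`
(Arora–Barak 2009, §1.2). [cite: AroraBarak2009, §1.2] -/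
theorem GapSVP.noLang_eq_image (γ : ℕ → ℝ) :
    GapSVP.noLang γ = GapSVPInstance.encode '' GapSVP.no γ := rfl

/-- Defining equation: `GapCVP.yesLang γ = GapCVPInstance.encode '' GapCVP.yes γ`
(Arora–Barak 2009, §1.2). [cite: AroraBarak2009, §1.2] -/
theorem GapCVP.yesLang_eq_image (γ : ℕ → ℝ) :
    GapCVP.yesLang γ = GapCVPInstance.encode '' GapCVP.yes γ := rfl

/-- Defining equation: `GapCVP.noLang γ = GapCVPInstance.encode '' GapCVP.no γ`
(Arora–Barak 2009, §1.2). [cite: AroraBarak2009, §1.2] -/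
theorem GapCVP.noLang_eq_image (γ : ℕ → ℝ) :
    GapCVP.noLang γ = GapCVPInstance.encode '' GapCVP.no γ := rfl

/-- The code of `(B, d)` lies in the YES language of `GapSVP_γ` iff `(B, d)` is a YES instance
(injectivity of the encoding; Mathlib `Computability.Encoding.encode_injective`). [folklore] -/
@[simp] theorem GapSVP.encode_mem_yesLang_iff (γ : ℕ → ℝ) (p : GapSVPInstance) :
    GapSVPInstance.encode p ∈ GapSVP.yesLang γ ↔ p ∈ GapSVP.yes γ :=
  gapSVPInstanceEncoding.mem_toLanguage_iff _ _

/-- The code of `(B, d)` lies in the NO language of `GapSVP_γ` iff `(B, d)` is a NO instance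
(Mathlib `Computability.Encoding.encode_injective`). [folklore] -/
@[simp] theorem GapSVP.encode_mem_noLang_iff (γ : ℕ → ℝ) (p : GapSVPInstance) :
    GapSVPInstance.encode p ∈ GapSVP.noLang γ ↔ p ∈ GapSVP.no γ :=
  gapSVPInstanceEncoding.mem_toLanguage_iff _ _

/-- The code of `((B, t), d)` lies in the YES language of `GapCVP_γ` iff it is a YES instance
(Mathlib `Computability.Encoding.encode_injective`). [folklore] -/
@[simp] theorem GapCVP.encode_mem_yesLang_iff (γ : ℕ → ℝ) (p : GapCVPInstance) :
    GapCVPInstance.encode p ∈ GapCVP.yesLang γ ↔ p ∈ GapCVP.yes γ :=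
  gapCVPInstanceEncoding.mem_toLanguage_iff _ _

/-- The code of `((B, t), d)` lies in the NO language of `GapCVP_γ` iff it is a NO instance
(Mathlib `Computability.Encoding.encode_injective`). [folklore] -/
@[simp] theorem GapCVP.encode_mem_noLang_iff (γ : ℕ → ℝ) (p : GapCVPInstance) :
    GapCVPInstance.encode p ∈ GapCVP.noLang γ ↔ p ∈ GapCVP.no γ :=
  gapCVPInstanceEncoding.mem_toLanguage_iff _ _

/-- For `γ ≥ 1` the YES and NO languages of `GapSVP_γ` are disjoint, so that
`(GapSVP.yesLang γ, GapSVP.noLang γ)` is a promise problem over `Bool` (the pair wrapped by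
G01's `PromiseProblem.ofEncoding`; Micciancio–Goldwasser 2002, Ch. 1, §1.2). [cite: MicciancioGoldwasser2002, Ch. 1  §1.2] -/
theorem gapSVP_lang_disjoint {γ : ℕ → ℝ} (hγ : ∀ n, 1 ≤ γ n) :
    Disjoint (GapSVP.yesLang γ) (GapSVP.noLang γ) := by
  change Disjoint (α := Set (List Bool)) (GapSVPInstance.encode '' GapSVP.yes γ)
    (GapSVPInstance.encode '' GapSVP.no γ)
  exact (Set.disjoint_image_iff GapSVPInstance.encode_injective).2 (gapSVP_disjoint hγ)

/-- For `γ ≥ 1` the YES and NO languages of `GapCVP_γ` are disjoint, so that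
`(GapCVP.yesLang γ, GapCVP.noLang γ)` is a promise problem over `Bool`
(Micciancio–Goldwasser 2002, Ch. 1, §1.2). [cite: MicciancioGoldwasser2002, Ch. 1  §1.2] -/
theorem gapCVP_lang_disjoint {γ : ℕ → ℝ} (hγ : ∀ n, 1 ≤ γ n) :
    Disjoint (GapCVP.yesLang γ) (GapCVP.noLang γ) := by
  change Disjoint (α := Set (List Bool)) (GapCVPInstance.encode '' GapCVP.yes γ)
    (GapCVPInstance.encode '' GapCVP.no γ)
  exact (Set.disjoint_image_iff GapCVPInstance.encode_injective).2 (gapCVP_disjoint hγ)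

/-! ### Elementary relations between the problems -/

/-- The trivial reduction from `GapSVP_γ` to `SVP_γ`: if `v` is any `SVP_γ` solution on `B`
(with `γ(n) ≥ 0`), the test `‖v‖ ≤ γ(n) · d` decides `GapSVP_γ` correctly on the promise — it
passes on every YES instance `(B, d)` (`‖v‖ ≤ γ λ₁ ≤ γ d`) and fails on every NO instance
(`‖v‖ ≥ λ₁ > γ d`) (Micciancio–Goldwasser 2002, Ch. 1, §1.2; Peikert 2016, §2.2). [cite: MicciancioGoldwasser2002, Ch. 1  §1.2] -/
theorem svp_decides_gapSVP {γ : ℕ → ℝ} {I : LatticeInstance} (hγ : 0 ≤ γ I.n)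
    {v : Fin I.n → ℤ} (hv : SVP.IsSolution γ I v) (d : ℚ) :
    ((I, d) ∈ GapSVP.yes γ → ‖intVecToEuclidean I.n v‖ ≤ γ I.n * (d : ℝ)) ∧
      ((I, d) ∈ GapSVP.no γ → γ I.n * (d : ℝ) < ‖intVecToEuclidean I.n v‖) :=
  ⟨fun h => hv.2.2.trans (mul_le_mul_of_nonneg_left h.2.2 hγ),
    fun h => lt_norm_of_mem_gapSVP_no h hv⟩

/-- The lattice instance `B⁽ⁱ⁾` obtained from `B` by doubling the `i`-th basis vector,
`B⁽ⁱ⁾ = (b₁, …, 2bᵢ, …, bₙ)` (Goldreich–Micciancio–Safra–Seifert, *Approximating shortest lattice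
vectors is not harder than approximating closest lattice vectors*, IPL 71 (1999), §3). [folklore] -/
def doubleRow (I : LatticeInstance) (i : Fin I.n) : LatticeInstance :=
  ⟨I.n, I.basis.updateRow i ((2 : ℤ) • I.basis i)⟩

/-- The dimension of `B⁽ⁱ⁾` is that of `B` (GMSS 1999, §3). [cite: GMSS1999, §3] -/
@[simp] theorem doubleRow_n (I : LatticeInstance) (i : Fin I.n) : (doubleRow I i).n = I.n := rfl

/-- The `i`-th GMSS instance of `CVP` attached to `B`: lattice `B⁽ⁱ⁾` (the `i`-th basis vector
doubled) and target `bᵢ` (Goldreich–Micciancio–Safra–Seifert 1999, §3). [cite: GoldreichMicciancioSafraSeifert1999, §3] -/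
def gmssInstance (I : LatticeInstance) (i : Fin I.n) : CVPInstance :=
  ⟨doubleRow I i, I.basis i⟩

/-- Doubling a basis vector preserves nonsingularity: `det B⁽ⁱ⁾ = 2 det B ≠ 0`
(GMSS 1999, §3; Mathlib `Matrix.det_updateRow_smul`). [cite: GMSS1999, §3] -/
theorem isNonsingular_doubleRow {I : LatticeInstance} (hI : I.IsNonsingular) (i : Fin I.n) :
    (doubleRow I i).IsNonsingular := by
  change (I.basis.updateRow i ((2 : ℤ) • I.basis i)).det ≠ 0
  rw [Matrix.det_updateRow_smul, Matrix.updateRow_eq_self]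
  exact mul_ne_zero two_ne_zero hI

/-- **Goldreich–Micciancio–Safra–Seifert (1999), Thm. 1** (mathematical form of the Cook
reduction from `GapSVP_γ` to `GapCVP_γ`, same dimension and same approximation factor): for a
lattice instance `B` of positive dimension and every threshold `d`,
* if `(B, d)` is a YES instance of `GapSVP_γ` then `(B⁽ⁱ⁾, bᵢ, d)` is a YES instance of
  `GapCVP_γ` for some `i` (a shortest vector `∑ cⱼ bⱼ` has some `cᵢ` odd, and then
  `dist(bᵢ, L(B⁽ⁱ⁾)) ≤ λ₁(L(B))`);
* if `(B, d)` is a NO instance of `GapSVP_γ` then `(B⁽ⁱ⁾, bᵢ, d)` is a NO instance of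
  `GapCVP_γ` for every `i` (`bᵢ - L(B⁽ⁱ⁾) ⊆ L(B) ∖ {0}`, so `dist(bᵢ, L(B⁽ⁱ⁾)) ≥ λ₁(L(B))`).
Hence `GapSVP_γ` reduces to `GapCVP_γ` with `n` (non-adaptive) queries. The hypothesis `n ≠ 0`
is needed for the YES direction only (for `n = 0`, `λ₁(⊥) = 0` is a junk value). [cite: GoldreichMicciancioSafraSeifert1999] -/
def gapSVP_reduces_to_gapCVP : Prop :=
  ∀ (γ : ℕ → ℝ) (I : LatticeInstance) (hn : I.n ≠ 0) (d : ℚ),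
    ((I, d) ∈ GapSVP.yes γ ↔ ∃ i, (gmssInstance I i, d) ∈ GapCVP.yes γ) ∧
      ((I, d) ∈ GapSVP.no γ → ∀ i, (gmssInstance I i, d) ∈ GapCVP.no γ)

/-- Sanity unfolding of `SIVP_γ`: every vector of an `SIVP_γ` solution is a lattice vector of
norm at most `γ(n) · λₙ(L(B))` (Micciancio–Goldwasser 2002, Ch. 7, Def. 7.1; Peikert 2016,
Def. 2.2.4). [cite: MicciancioGoldwasser2002, Ch. 7  Def. 7.1] -/
theorem sivp_solution_norm_le {γ : ℕ → ℝ} {I : LatticeInstance} {v : Fin I.n → Fin I.n → ℤ}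
    (hv : SIVP.IsSolution γ I v) (i : Fin I.n) :
    intVecToEuclidean I.n (v i) ∈ I.lattice ∧
      ‖intVecToEuclidean I.n (v i)‖ ≤ γ I.n * successiveMinimum I.lattice I.n :=
  ⟨hv.2.1 i, hv.2.2 i⟩

/-- Sanity: for `γ(n) ≥ 1` an `SIVP_γ` solution on a nonsingular instance witnesses
`λₙ(L(B)) ≤ max ‖vᵢ‖ ≤ γ(n) · λₙ(L(B))`, i.e. the `n` vectors are `ℝ`-linearly independent
lattice vectors inside the ball of radius `γ(n) λₙ` (Micciancio–Goldwasser 2002, Ch. 7,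
Def. 7.1). [cite: MicciancioGoldwasser2002, Ch. 7  Def. 7.1] -/
def sivp_solution_linearIndependent_real : Prop :=
  ∀ {γ : ℕ → ℝ} {I : LatticeInstance} {v : Fin I.n → Fin I.n → ℤ} (hv : SIVP.IsSolution γ I v),
    LinearIndependent ℝ fun i => intVecToEuclidean I.n (v i)

/-- The `uSVP_γ` promise unfolded, with `λ₁` written as the first successive minimum:
`B` is nonsingular and `γ(n) · λ₁(L(B)) ≤ λ₂(L(B))` (Regev 2009, §1; Peikert 2016, §2.2;
Lyubashevsky–Micciancio 2009). [cite: Regev2009, §1] -/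
def usvp_promise_iff : Prop :=
  ∀ (γ : ℕ → ℝ) (I : LatticeInstance),
    USVP.Promise γ I ↔ I.IsNonsingular ∧
      γ I.n * successiveMinimum I.lattice 1 ≤ successiveMinimum I.lattice 2

/- interim proof relied on results that are now named facts (D-0014); demoted to a fact by the M5 import, proof preserved:
:= by
  rw [successiveMinimum_one_eq_minNorm]
  rfl
-/

end Literature.Algebra.EuclideanLattices
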